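import Literature.NumberTheory.EllipticCurves.PAdicBSD
import HarnessLib

/-!
# BSD family — Kato 2004, Thm 17.4 (1)(2) at an ARBITRARY good ordinary prime (named fact)

Topic `Literature/NumberTheory/EllipticCurves`.  ONE named fact and its projection from the
tree's odd-`p` fact; no other content.

K. Kato, *`p`-adic Hodge theory and values of zeta functions of modular forms*, Astérisque 295
(2004), Thm 17.4, p. 273, clauses (1)(2), for the newform `f` of a (globally minimal) elliptic
curve `E/ℚ` with good ordinary reduction at the prime `p` and the cyclotomic `ℤ_p`-extension
`ℚ_∞/ℚ`: (1) the Pontryagin dual `X = X(E/ℚ_∞)` of `Sel_{p^∞}(E/ℚ_∞)` is a torsion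
`Λ = ℤ_p⟦T⟧`-module; (2) `char_Λ X` divides the `p`-adic `L`-function in `Λ[1/p]`, i.e.
`p^n · L_p(E,T) = ι g` for some `n ≥ 0` and some `g ∈ char_Λ X`.

The tree's named fact `Literature.NumberTheory.EllipticCurves.kato_divisibility` (file `PAdicBSD`)
vendors Thm 17.4 with the parity binder `hp : p ≠ 2` in front of ALL THREE clauses, although in
the source the parity hypothesis is attached to the integral clause (3) only (Thm 17.4 (3),
p. 273; Thm 12.5 (4), p. 222; 17.13, pp. 279–280: "(17.13.1) … is exact if `p ≠ 2`, and is exact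
upto `×2` in the case `p = 2`" — harmless at the height-one primes `𝔭 ∌ p` of clause (2)); the
inputs Kato quotes at `p = 2` are in print (Kato, Kodai Math. J. 22 (1999), Thm. 0.8; Rubin,
*Euler systems*, AWS 1999 notes, Ch. II Thms. 3.2–3.4).  The statement below is clauses (1)(2)
at the prime `p` with NO parity binder: it is, token for token, the hypothesis `hdiv` of the
ACCEPTED reduction `kato_selmerCorank_le_order_padicLFunction_allPrimes_of_divisibility`
(namespace `Literature.NumberTheory.EllipticCurves`, file `KatoRankBoundAllPrimesProofs.lean`,
p139061), vendored as a named fact at the request of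
promote event 4573496 (16 provefact sessions on
`kato_selmerCorank_le_order_padicLFunction_allPrimes`, Kato Thm 18.4 at every prime; librarian
sweep g40, 2026-08-17).  With it that fact is ONE line:
`kato_selmerCorank_le_order_padicLFunction_allPrimes_of_divisibility W p (h W p)`, i.e. proved
modulo this single named input; at odd `p` the input is a projection of `kato_divisibility`
(`kato_divisibility_allPrimes_of_kato_divisibility` below, proved).
Deliberately NOT here: the integral clause (3), Iwasawa cohomology, any Euler system.

## References

* K. Kato, *`p`-adic Hodge theory and values of zeta functions of modular forms*, Astérisque 295
  (2004), 117–290: Thm 12.5 (pp. 221–222), Thm 13.4 (p. 226), Thm 17.4 (p. 273), 17.13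
  (pp. 279–280), Thm 18.4 (p. 281). [Kato2004Asterisque]
* K. Kato, *Euler systems, Iwasawa theory, and Selmer groups*, Kodai Math. J. 22 (1999),
  Thm. 0.8. [Kato1999Kodai]
* K. Rubin, *Euler systems*, Arizona Winter School 1999 lecture notes, Ch. II Thms. 3.2–3.4.
  [Rubin1999AWSEulerSystems]
-/

noncomputable section

open scoped MatrixGroups ModularForm

open CongruenceSubgroup WeierstrassCurve Literature.NumberTheory.EllipticCurves.ModularForms

namespace Literature.NumberTheory.EllipticCurves

variable (W : WeierstrassCurve ℚ) [W.IsElliptic] [W.IsGloballyMinimal] (p : ℕ) [Fact p.Prime]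
  {N : ℕ} [NeZero N] {f : CuspForm (Gamma0 N) 2}

/-- **Kato 2004, Thm 17.4 (1)(2) at the prime `p` (no parity hypothesis).**  Let `E/ℚ` (globally
minimal model `W`) have good ordinary reduction at `p`, let `κ = ℚ_∞/ℚ` be the cyclotomic
`ℤ_p`-extension with topological generator `γ` matching the cyclotomic variable
(`IsCyclotomicVariable`), let `f` be the newform of `E` and let `D` be any Pontryagin-dual datum
(`X = D.X = X(E/ℚ_∞)`, `Λ = ℤ_p⟦T⟧`, `T = γ - 1`).  Then (1) `X` is a torsion `Λ`-module and
(2) `p^n · L_p(E,T) = ι g` for some `n : ℕ` and some `g ∈ char_Λ X` (`char_Λ X ∣ L_p(E,T)` in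
`Λ[1/p]`).  As printed (Thm. 17.4, p. 273): "(1) `X(T)` is a torsion `Λ`-module. (2) …
`length_{Λ_𝔭}(X(T)_𝔭) ≤ ord_𝔭(L_{p-adic,α,ω,γ}(f))` for any prime ideal `𝔭` of `Λ` of height one
which does not contain `p`" — clauses (1)(2) carry no parity restriction (only (3) assumes
`p ≠ 2`).  Verbatim the hypothesis `hdiv` of
`kato_selmerCorank_le_order_padicLFunction_allPrimes_of_divisibility`; equal to clauses (1)(2) of
`kato_divisibility W p` with its binder `hp : p ≠ 2` removed.
[cite: Kato2004Asterisque, Thm. 17.4 (1)(2) (p. 273), with 17.13 (pp. 279–280)] -/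
def kato_divisibility_allPrimes : Prop :=
  ∀ (κ : ZpExtension ℚ p) (γ : Field.absoluteGaloisGroup ℚ), κ.IsCyclotomic →
    κ.IsTopGenerator γ → IsCyclotomicVariable p γ → IsOrdinaryAt W p → IsNewformOf W f →
    ∀ D : W.SelmerDualData κ γ, D.IsTorsion ∧
      ∃ (n : ℕ) (g : IwasawaAlgebra p), g ∈ D.charIdeal ∧
        iwasawaToPowerSeries p g =
          PowerSeries.C ((p : ℚ_[p]) ^ n) * padicLFunction f (unitRoot W p : ℚ_[p])

omit [W.IsElliptic] in
/-- At an **odd** prime, `kato_divisibility_allPrimes W p` is clauses (1)(2) of the tree's named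
fact `kato_divisibility W p` (Kato 2004, Thm 17.4, vendored with `p ≠ 2`).
[cite: Kato2004Asterisque, Thm. 17.4 (1)(2) (p. 273)] -/
theorem kato_divisibility_allPrimes_of_kato_divisibility (hp : p ≠ 2)
    (hkato : ∀ (κ : ZpExtension ℚ p) (γ : Field.absoluteGaloisGroup ℚ),
      kato_divisibility W p (κ := κ) (γ := γ) (f := f)) :
    kato_divisibility_allPrimes W p (f := f) :=
  fun κ γ hκ hγ hγ' hord hf D =>
    let h := hkato κ γ hp hord hκ hγ hγ' hf D
    ⟨h.1, h.2.1⟩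

end Literature.NumberTheory.EllipticCurves

end
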